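import Mathlib
import HarnessLib
import Summits.HubbardSuperconductivity.HubbardSuperconductivity.Theorems.KLProgrammeKLRegimeSplitPredicatesV3

/-!
# Route `KLProgramme` — ENGINE child gen 8 (stmt-HubbardSuperconductivity-20437 `KLRegimeEngineV17F2`), stub (b) conj. 4 / class #7:
# the BUDGET ARITHMETIC of the two-leg read-out — per-scale DECAY `2^{−j}` makes the sum of second-order slice increments n-FREE and `O(U²)`;
# FLAT per-scale increments do not even stay bounded (cell gate-hubbard-kl, seat hubbard-kl-k3c2-p3 g8; memo W3-CURRENCY.md §0/§4)

WHY.  The class-#7 rows of stub (e) (`|z_n − 1| ≤ Z·U²` on the shell, `‖∇(Σ_loc − K_n)‖ ≤ S·U²` on the tube) are first moments of the two-leg kernel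
of the scale-`n` action, i.e. sums over the scales `j < n` of the first moments of the two-leg SLICE INCREMENTS.  A second-order increment born at
scale `j` carries the square of the sign-blind coupling size `ε_j = epsCoupling P U j = Klam·(|U| + U²·j)` (`…SplitPredicatesV3`).  Two readings:

* with the two-leg power-counting improvement of the curved Fermi curve (BGM 2006 §3 (3.6): `sup_ω̄ J^{(2)}_{h,n,ω̄}(…; j) ≤ (c_j|U|)^n |h| γ^{(2−j)h}`,
  one factor `γ^{h/2} = 2^{−j}` per scale on the first moment) the budget line is **`Σ_{j<n} ε_j²·2^{−j} ≤ 12·Klam²·U²`** for `|U| ≤ 1` —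
  n-FREE and `O(U²)`, the registered `Z·U²` / `Zs₂·U²` shape (`sum_epsCoupling_sq_mul_inv_two_pow_le`, abstract-budget form `sum_le_of_le_epsCoupling_sq_decay`);
* at the F = 1 law's face value (no improvement; every increment `O(ε_j²)` flat in `j`) the same sum is
  **`Σ_{j<n} ε_j² ≥ Klam²·U⁴·(n−1)³/3`** (`klam_sq_mul_pow_four_mul_le_sum_epsCoupling_sq`), i.e. `≍ Klam²c³/(3 ln³4·U²)` at the bottom of the KL regime
  `n ≈ c/(U² ln 4)`: unbounded as `U → 0` at fixed `c` — the decay is not a refinement of the fourth conjunct of (b) conj. 4, it is what makes it provable.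

Elementary closed forms used: `Σ_{j<n} 2^{−j} = 2 − 2·2^{−n}`, `Σ_{j<n} j·2^{−j} = 2 − (n+1)·2^{1−n}`, `Σ_{j<n} j²·2^{−j} = 6 − (n²+2n+3)·2^{1−n}`,
`Σ_{j<n} j² = (n−1)n(2n−1)/6`.  Pure real analysis; no definitions; nothing about the model is asserted; nothing asserts superconductivity.
References: BGM 2006 Thm 2.1 (2.77) vs §3 (3.5)–(3.6) [cite: BenfattoGiulianiMastropietro2006].
-/

noncomputable section

namespace Summit.HubbardSuperconductivity.HubbardSuperconductivity.Theorems.EngineV8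

set_option linter.dupNamespace false -- summit = problem name (single-conjunct summit), D-0017

open Real Finset
open Summit.HubbardSuperconductivity.HubbardSuperconductivity.Theorems.KLRegimeSplit

/-! ## §1 The three geometric sums with polynomial weights (closed forms and the bounds `2, 6, 12`) -/

/-- `Σ_{j<n} (1/2)^j = 2 − 2·(1/2)^n`. [folklore] -/
theorem sum_range_half_pow_eq (n : ℕ) : ∑ j ∈ range n, (1 / 2 : ℝ) ^ j = 2 - 2 * (1 / 2 : ℝ) ^ n := by
  induction n with
  | zero => simp
  | succ n ih => rw [sum_range_succ, ih]; ring

/-- `Σ_{j<n} j·(1/2)^j = 2 − (n+1)·2·(1/2)^n`. [folklore] -/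
theorem sum_range_mul_half_pow_eq (n : ℕ) :
    ∑ j ∈ range n, (j : ℝ) * (1 / 2 : ℝ) ^ j = 2 - ((n : ℝ) + 1) * 2 * (1 / 2 : ℝ) ^ n := by
  induction n with
  | zero => simp
  | succ n ih => rw [sum_range_succ, ih]; push_cast; ring

/-- `Σ_{j<n} j²·(1/2)^j = 6 − (n² + 2n + 3)·2·(1/2)^n`. [folklore] -/
theorem sum_range_sq_mul_half_pow_eq (n : ℕ) :
    ∑ j ∈ range n, (j : ℝ) ^ 2 * (1 / 2 : ℝ) ^ j = 6 - ((n : ℝ) ^ 2 + 2 * n + 3) * 2 * (1 / 2 : ℝ) ^ n := by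
  induction n with
  | zero => norm_num
  | succ n ih => rw [sum_range_succ, ih]; push_cast; ring

/-- `Σ_{j<n} j·(1/2)^j ≤ 2`. [folklore] -/
theorem sum_range_mul_half_pow_le_two (n : ℕ) : ∑ j ∈ range n, (j : ℝ) * (1 / 2 : ℝ) ^ j ≤ 2 := by
  rw [sum_range_mul_half_pow_eq]
  have : (0 : ℝ) ≤ ((n : ℝ) + 1) * 2 * (1 / 2 : ℝ) ^ n := by positivity
  linarith

/-- `Σ_{j<n} j²·(1/2)^j ≤ 6`. [folklore] -/
theorem sum_range_sq_mul_half_pow_le_six (n : ℕ) : ∑ j ∈ range n, (j : ℝ) ^ 2 * (1 / 2 : ℝ) ^ j ≤ 6 := by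
  rw [sum_range_sq_mul_half_pow_eq]
  have : (0 : ℝ) ≤ ((n : ℝ) ^ 2 + 2 * n + 3) * 2 * (1 / 2 : ℝ) ^ n := by positivity
  linarith

/-- `Σ_{j<n} (1 + j)²·(1/2)^j ≤ 12` (`= Σ (1 + 2j + j²)(1/2)^j ≤ 2 + 4 + 6`). [folklore] -/
theorem sum_range_one_add_sq_mul_half_pow_le (n : ℕ) : ∑ j ∈ range n, (1 + (j : ℝ)) ^ 2 * (1 / 2 : ℝ) ^ j ≤ 12 := by
  have h : ∑ j ∈ range n, (1 + (j : ℝ)) ^ 2 * (1 / 2 : ℝ) ^ j =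
      ∑ j ∈ range n, (1 / 2 : ℝ) ^ j + 2 * ∑ j ∈ range n, (j : ℝ) * (1 / 2 : ℝ) ^ j + ∑ j ∈ range n, (j : ℝ) ^ 2 * (1 / 2 : ℝ) ^ j := by
    rw [mul_sum, ← sum_add_distrib, ← sum_add_distrib]; exact sum_congr rfl fun j _ => by ring
  -- (`Σ_{j<n} (1/2)^j ≤ 2` is `Literature.Computability.Complexity.AdBPPSim.sum_half_pow_le_two`; we use the closed form instead of importing it)
  rw [h, sum_range_half_pow_eq]
  have h0 : (0 : ℝ) ≤ (1 / 2 : ℝ) ^ n := by positivity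
  linarith [sum_range_mul_half_pow_le_two n, sum_range_sq_mul_half_pow_le_six n]

/-- `Σ_{j<n} j² = (n−1)·n·(2n−1)/6` over `ℝ`. [folklore] -/
theorem sum_range_natCast_sq_eq (n : ℕ) : ∑ j ∈ range n, ((j : ℝ)) ^ 2 = ((n : ℝ) - 1) * n * (2 * n - 1) / 6 := by
  induction n with
  | zero => simp
  | succ n ih => rw [sum_range_succ, ih]; push_cast; ring

/-- `(n−1)³/3 ≤ Σ_{j<n} j²` over `ℝ` (for `n = 0` the left side is `−1/3`). [folklore] -/
theorem sub_one_pow_three_div_three_le_sum_range_sq (n : ℕ) : ((n : ℝ) - 1) ^ 3 / 3 ≤ ∑ j ∈ range n, ((j : ℝ)) ^ 2 := by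
  rw [sum_range_natCast_sq_eq]
  rcases Nat.eq_zero_or_pos n with h | h
  · subst h; norm_num
  · have h1 : (1 : ℝ) ≤ n := by exact_mod_cast h
    nlinarith [mul_nonneg (sub_nonneg.2 h1) (by linarith : (0 : ℝ) ≤ 3 * n - 2)]

/-! ## §2 The square of the coupling size -/

/-- `ε_j² = Klam²·(|U| + U²j)²`. -/
theorem epsCoupling_sq (P : SplitConsts) (U : ℝ) (j : ℕ) : epsCoupling P U j ^ 2 = P.Klam ^ 2 * (|U| + U ^ 2 * j) ^ 2 := by
  unfold epsCoupling; ring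

/-- For `|U| ≤ 1`: `(|U| + U²j)² ≤ U²·(1 + j)²` (factor `|U| + U²j = |U|·(1 + |U|j)`). -/
theorem abs_add_sq_mul_sq_le {U : ℝ} (hU : |U| ≤ 1) (j : ℕ) : (|U| + U ^ 2 * j) ^ 2 ≤ U ^ 2 * (1 + (j : ℝ)) ^ 2 := by
  have ha : 0 ≤ |U| := abs_nonneg U
  have hU2 : U ^ 2 = |U| ^ 2 := (sq_abs U).symm
  have hj : (0 : ℝ) ≤ j := Nat.cast_nonneg j
  have h1 : |U| + U ^ 2 * j ≤ |U| * (1 + j) := by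
    rw [hU2]; nlinarith [mul_nonneg ha hj, mul_nonneg (mul_nonneg ha hj) (sub_nonneg.2 hU)]
  have h0 : 0 ≤ |U| + U ^ 2 * j := by positivity
  calc (|U| + U ^ 2 * j) ^ 2 ≤ (|U| * (1 + j)) ^ 2 := pow_le_pow_left₀ h0 h1 2
    _ = U ^ 2 * (1 + (j : ℝ)) ^ 2 := by rw [mul_pow, sq_abs]

/-- For `|U| ≤ 1`: `ε_j² ≤ Klam²·U²·(1 + j)²`. -/
theorem epsCoupling_sq_le (P : SplitConsts) {U : ℝ} (hU : |U| ≤ 1) (j : ℕ) :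
    epsCoupling P U j ^ 2 ≤ P.Klam ^ 2 * U ^ 2 * (1 + (j : ℝ)) ^ 2 := by
  rw [epsCoupling_sq, mul_assoc]
  exact mul_le_mul_of_nonneg_left (abs_add_sq_mul_sq_le hU j) (sq_nonneg _)

/-- `Klam²·U⁴·j² ≤ ε_j²` (drop `|U| ≥ 0`). -/
theorem klam_sq_mul_pow_four_mul_sq_le_epsCoupling_sq (P : SplitConsts) (U : ℝ) (j : ℕ) :
    P.Klam ^ 2 * U ^ 4 * (j : ℝ) ^ 2 ≤ epsCoupling P U j ^ 2 := by
  rw [epsCoupling_sq, mul_assoc]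
  refine mul_le_mul_of_nonneg_left ?_ (sq_nonneg _)
  have ha : 0 ≤ |U| := abs_nonneg U
  have hj : (0 : ℝ) ≤ U ^ 2 * j := by positivity
  calc U ^ 4 * (j : ℝ) ^ 2 = (U ^ 2 * j) ^ 2 := by ring
    _ ≤ (|U| + U ^ 2 * j) ^ 2 := pow_le_pow_left₀ hj (by linarith) 2

/-! ## §3 DECAY ⇒ n-free `O(U²)` budget -/

/-- **`Σ_{j<n} ε_j²·(1/2)^j ≤ 12·Klam²·U²`** for `|U| ≤ 1` — n-free and `O(U²)`. -/
theorem sum_epsCoupling_sq_mul_half_pow_le (P : SplitConsts) {U : ℝ} (hU : |U| ≤ 1) (n : ℕ) :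
    ∑ j ∈ range n, epsCoupling P U j ^ 2 * (1 / 2 : ℝ) ^ j ≤ 12 * P.Klam ^ 2 * U ^ 2 := by
  calc ∑ j ∈ range n, epsCoupling P U j ^ 2 * (1 / 2 : ℝ) ^ j
      ≤ ∑ j ∈ range n, P.Klam ^ 2 * U ^ 2 * ((1 + (j : ℝ)) ^ 2 * (1 / 2 : ℝ) ^ j) := sum_le_sum fun j _ => by
        rw [← mul_assoc]; exact mul_le_mul_of_nonneg_right (epsCoupling_sq_le P hU j) (by positivity)
    _ = P.Klam ^ 2 * U ^ 2 * ∑ j ∈ range n, (1 + (j : ℝ)) ^ 2 * (1 / 2 : ℝ) ^ j := by rw [mul_sum]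
    _ ≤ P.Klam ^ 2 * U ^ 2 * 12 := mul_le_mul_of_nonneg_left (sum_range_one_add_sq_mul_half_pow_le n) (by positivity)
    _ = 12 * P.Klam ^ 2 * U ^ 2 := by ring

/-- **`Σ_{j<n} ε_j²·(2^j)⁻¹ ≤ 12·Klam²·U²`** for `|U| ≤ 1` (the `2^{−j}` form of the law units). -/
theorem sum_epsCoupling_sq_mul_inv_two_pow_le (P : SplitConsts) {U : ℝ} (hU : |U| ≤ 1) (n : ℕ) :
    ∑ j ∈ range n, epsCoupling P U j ^ 2 * ((2 : ℝ) ^ j)⁻¹ ≤ 12 * P.Klam ^ 2 * U ^ 2 := by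
  have h := sum_epsCoupling_sq_mul_half_pow_le P hU n
  simpa only [one_div, inv_pow] using h

/-- **ABSTRACT-BUDGET FORM**: if the per-scale two-leg read-out masses satisfy `b j ≤ C·ε_j²·(2^j)⁻¹` for `j < n` (`C ≥ 0`, `|U| ≤ 1`), then
`Σ_{j<n} b j ≤ 12·C·Klam²·U²` — n-free, `O(U²)`. -/
theorem sum_le_of_le_epsCoupling_sq_decay (P : SplitConsts) {U C : ℝ} (hU : |U| ≤ 1) (hC : 0 ≤ C) {n : ℕ} {b : ℕ → ℝ}
    (hb : ∀ j < n, b j ≤ C * (epsCoupling P U j ^ 2 * ((2 : ℝ) ^ j)⁻¹)) : ∑ j ∈ range n, b j ≤ 12 * C * P.Klam ^ 2 * U ^ 2 := by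
  calc ∑ j ∈ range n, b j ≤ ∑ j ∈ range n, C * (epsCoupling P U j ^ 2 * ((2 : ℝ) ^ j)⁻¹) :=
        sum_le_sum fun j hj => hb j (mem_range.1 hj)
    _ = C * ∑ j ∈ range n, epsCoupling P U j ^ 2 * ((2 : ℝ) ^ j)⁻¹ := by rw [mul_sum]
    _ ≤ C * (12 * P.Klam ^ 2 * U ^ 2) := mul_le_mul_of_nonneg_left (sum_epsCoupling_sq_mul_inv_two_pow_le P hU n) hC
    _ = 12 * C * P.Klam ^ 2 * U ^ 2 := by ring

/-- **ABSTRACT-BUDGET FORM WITH A GEOMETRIC RATE `q ≤ 1/2`**: `b j ≤ C·ε_j²·q^j` (`0 ≤ q ≤ 1/2`, `C ≥ 0`, `|U| ≤ 1`) ⇒ `Σ_{j<n} b j ≤ 12·C·Klam²·U²`. -/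
theorem sum_le_of_le_epsCoupling_sq_geom (P : SplitConsts) {U C q : ℝ} (hU : |U| ≤ 1) (hC : 0 ≤ C) (hq0 : 0 ≤ q) (hq : q ≤ 1 / 2)
    {n : ℕ} {b : ℕ → ℝ} (hb : ∀ j < n, b j ≤ C * (epsCoupling P U j ^ 2 * q ^ j)) : ∑ j ∈ range n, b j ≤ 12 * C * P.Klam ^ 2 * U ^ 2 := by
  refine sum_le_of_le_epsCoupling_sq_decay P hU hC fun j hj => (hb j hj).trans (mul_le_mul_of_nonneg_left ?_ hC)
  rw [← inv_pow]
  exact mul_le_mul_of_nonneg_left (pow_le_pow_left₀ hq0 (by rw [← one_div]; exact hq) j) (sq_nonneg _)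

/-! ## §4 NO DECAY ⇒ no n-free budget: the flat sum grows like `U⁴·n³` -/

/-- **`Klam²·U⁴·(n−1)³/3 ≤ Σ_{j<n} ε_j²`** — flat per-scale second-order increments are NOT summable uniformly in the depth `n`
(`≍ Klam²·c³/(3 ln³4·U²)` at `n ≈ c/(U² ln 4)`). -/
theorem klam_sq_mul_pow_four_mul_le_sum_epsCoupling_sq (P : SplitConsts) (U : ℝ) (n : ℕ) :
    P.Klam ^ 2 * U ^ 4 * (((n : ℝ) - 1) ^ 3 / 3) ≤ ∑ j ∈ range n, epsCoupling P U j ^ 2 := by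
  calc P.Klam ^ 2 * U ^ 4 * (((n : ℝ) - 1) ^ 3 / 3) ≤ P.Klam ^ 2 * U ^ 4 * ∑ j ∈ range n, ((j : ℝ)) ^ 2 :=
        mul_le_mul_of_nonneg_left (sub_one_pow_three_div_three_le_sum_range_sq n) (by positivity)
    _ = ∑ j ∈ range n, P.Klam ^ 2 * U ^ 4 * ((j : ℝ)) ^ 2 := by rw [mul_sum]
    _ ≤ ∑ j ∈ range n, epsCoupling P U j ^ 2 := sum_le_sum fun j _ => klam_sq_mul_pow_four_mul_sq_le_epsCoupling_sq P U j

/-- **The two readings side by side** (`|U| ≤ 1`, `Klam ≠ 0`, `U ≠ 0`, `n ≥ 2`): the decaying sum is `≤ 12·Klam²·U²` while the flat one is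
`≥ Klam²·U⁴·(n−1)³/3`; in particular the flat sum exceeds the decaying budget as soon as `(n−1)³ > 36/U²`. -/
theorem sum_epsCoupling_sq_gt_decay_budget (P : SplitConsts) {U : ℝ} (hK : P.Klam ≠ 0) (hU0 : U ≠ 0) {n : ℕ}
    (hn : 36 / U ^ 2 < ((n : ℝ) - 1) ^ 3) : 12 * P.Klam ^ 2 * U ^ 2 < ∑ j ∈ range n, epsCoupling P U j ^ 2 := by
  refine lt_of_lt_of_le ?_ (klam_sq_mul_pow_four_mul_le_sum_epsCoupling_sq P U n)
  have hK2 : 0 < P.Klam ^ 2 := by positivity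
  have hU2 : 0 < U ^ 2 := by positivity
  have h36 : 36 < U ^ 2 * ((n : ℝ) - 1) ^ 3 := by
    have := (div_lt_iff₀ hU2).1 hn; linarith [this]
  nlinarith [mul_pos hK2 hU2]

end Summit.HubbardSuperconductivity.HubbardSuperconductivity.Theorems.EngineV8

end
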